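import Summits.ValiantsHypothesis.ValiantsHypothesis.Theorems.GrenetZeonAlgDcQPSplit
import Summits.ValiantsHypothesis.ValiantsHypothesis.Theorems.GrenetZeonTransferToDc
import Summits.ValiantsHypothesis.ValiantsHypothesis.Theorems.HubHub
import Literature.Computability.AlgebraicComplexity.AlgDetRepr
import Literature.Computability.AlgebraicComplexity.ValiantClasses
import Literature.Computability.AlgebraicComplexity.ValiantConjectureProofs
import Literature.Computability.AlgebraicComplexity.VPDeterminantalQPProofs
import HarnessLib

/-!
# Route GrenetZeon — the deciding conjunction needs `PolySizeQPAlgebra` (stmt-ValiantsHypothesis-8064)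
# only INFINITELY OFTEN

The route closes `ValiantsHypothesis` from `AlgDcQP` (for every `c`, for ALL LARGE `n`, no
`(m, s)`-representation of `per_n` with `m, s ≤ 2^((log₂ n + c)^c)`), derived from
`AbelianizationQP` (8063) and `PolySizeQPAlgebra` (8064, also an "all large `n`" statement).  But
the glue `SliceToDetqp`/`DcqpToVH` only consumes `¬ IsQPBounded (dc per_n)`, an INFINITELY-OFTEN
statement.  This file records, kernel-checked, that the almost-everywhere quantifiers are surplus:

* `algDcQP_io_of_abelianizationQP` — `AbelianizationQP` together with the infinitely-often form of
  8064 ("for every `c` and `n₀` there is `n ≥ n₀` at which `per_n` has no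
  `(n^c + c, 2^((log₂ n + c)^c))`-representation") gives the infinitely-often form of `AlgDcQP`
  (same bookkeeping as the proved split `AlgDcQPSplit.AlgDcQP_of_subs`: transfer
  `transferToDc_proof`, abelianize, `log_transfer_le`/`step_pow`).
* `not_isQPBounded_dc_of_algDcQP_io` — the infinitely-often form of `AlgDcQP` already gives
  `¬ IsQPBounded (n ↦ dc(per_n))` (at a good `n`, the attained representation of size `dc(per_n)`
  is an `(m, 1)`-representation in the box).
* `valiantsHypothesis_of_abelianizationQP_of_polySizeBox_io` — hence
  `AbelianizationQP → (8064 infinitely often) → ValiantsHypothesis`, through the proved hub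
  (`Hub.valiantsHypothesis_of_not_isVPFamily_per`, `VP ⊆ VQP` for `dc`, Valiant's `per ∈ VNP`).

Planning signal (honest, tag WEAKER): the deciding conjunction `8063 ∧ 8064` may be replaced by
`8063 ∧ 8064-i.o.`; and by the dichotomy `abelianizationQP_or_polySizeBox_io`
(`Theorems/GrenetZeonAbelianizationQPDichotomy.lean`) the i.o. form of 8064 is AUTOMATIC whenever
8063 fails — so the route's entire risk, given 8063, is the i.o. exclusion of `(poly, qp)`
representations; and if 8063 is false the route is dead regardless.  Nothing here proves either
binder or VP ≠ VNP.  Axioms `propext`, `Classical.choice`, `Quot.sound`.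
-/

set_option linter.dupNamespace false

noncomputable section

namespace Summit.ValiantsHypothesis.ValiantsHypothesis.Theorems.GrenetZeonPolySizeQPAlgebra

open MvPolynomial Matrix
open Literature.Computability.AlgebraicComplexity
open Summit.ValiantsHypothesis.ValiantsHypothesis.Theses.GrenetZeon

/-- The almost-everywhere route target implies its infinitely-often form (orientation).
[folklore] -/
theorem algDcQP_io_of_algDcQP (hA : AlgDcQP) (c n₀ : ℕ) :
    ∃ n ≥ n₀, ∀ m s : ℕ, m ≤ 2 ^ ((Nat.log 2 n + c) ^ c) → s ≤ 2 ^ ((Nat.log 2 n + c) ^ c) →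
      ¬ HasAlgDetRepr (perPoly (Fin n) ℂ) m s := by
  obtain ⟨n₁, h⟩ := hA c
  exact ⟨max n₀ n₁, le_max_left _ _, fun m s hm hs => h _ (le_max_right _ _) m s hm hs⟩

/-- **`AbelianizationQP` + (8064 infinitely often) ⟹ `AlgDcQP` infinitely often.**  Given `c`, let
`a` be the abelianization constant and `C := (c + a + 8)(a + 1)`; at an `n ≥ max n₀ 1` where the
`C`-box of `PolySizeQPAlgebra` is empty, an `(m, s)`-representation with `m, s ≤ 2^((log₂ n + c)^c)`
would transfer (`transferToDc_proof`) to an affine one of size `M = (s+1)(m+1)^3`, abelianize to an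
`(n^a + a, 2^((log₂ M + a)^a))`-representation, and land inside the empty box
(`AlgDcQPSplit.log_transfer_le`, `step_pow`). [cite: HrubesYehudayoff2011, Thm. 4.2] -/
theorem algDcQP_io_of_abelianizationQP (hA : AbelianizationQP)
    (hio : ∀ c n₀ : ℕ, ∃ n ≥ n₀,
      ¬ HasAlgDetRepr (perPoly (Fin n) ℂ) (n ^ c + c) (2 ^ ((Nat.log 2 n + c) ^ c)))
    (c n₀ : ℕ) :
    ∃ n ≥ n₀, ∀ m s : ℕ, m ≤ 2 ^ ((Nat.log 2 n + c) ^ c) → s ≤ 2 ^ ((Nat.log 2 n + c) ^ c) →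
      ¬ HasAlgDetRepr (perPoly (Fin n) ℂ) m s := by
  obtain ⟨a, ha⟩ := hA
  obtain ⟨n, hn, hno⟩ := hio ((c + a + 8) * (a + 1)) (max n₀ 1)
  have hn₀n : n₀ ≤ n := le_of_max_le_left hn
  have h1n : 1 ≤ n := le_of_max_le_right hn
  have hCa : a ≤ (c + a + 8) * (a + 1) :=
    calc a ≤ (c + a + 8) * 1 := by omega
      _ ≤ (c + a + 8) * (a + 1) := Nat.mul_le_mul_left _ (by omega)
  refine ⟨n, hn₀n, fun m s hm hs hrep => hno ?_⟩
  -- transfer to ordinary determinantal complexity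
  have hdc : HasDetRepr (perPoly (Fin n) ℂ) ((s + 1) * (m + 1) ^ 3) :=
    GrenetZeon.transferToDc_proof n m s hrep
  -- abelianize at quasi-polynomial cost
  have hrep' : HasAlgDetRepr (perPoly (Fin n) ℂ) (n ^ a + a)
      (2 ^ ((Nat.log 2 ((s + 1) * (m + 1) ^ 3) + a) ^ a)) :=
    ha n ((s + 1) * (m + 1) ^ 3) h1n hdc
  -- and pad into the empty box
  refine hrep'.mono (Nat.add_le_add (Nat.pow_le_pow_right h1n hCa) hCa) ?_
  exact Nat.pow_le_pow_right (by norm_num)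
    ((Nat.pow_le_pow_left (Nat.add_le_add_right
      (GrenetZeon.AlgDcQPSplit.log_transfer_le _ c m s hm hs) a) a).trans
      (GrenetZeon.AlgDcQPSplit.step_pow _ c a))

/-- **The infinitely-often form of `AlgDcQP` gives `¬ IsQPBounded (n ↦ dc(per_n))`**: if
`dc(per_n) ≤ 2^((log₂ n + c)^c)` for all `n`, then at a good `n` the attained affine representation
of size `dc(per_n)` (`hasDetRepr_determinantalComplexity_holds`) is an `(m, 1)`-representation in the
excluded box. [cite: MignonRessayre2004, §1] -/
theorem not_isQPBounded_dc_of_algDcQP_io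
    (h : ∀ c n₀ : ℕ, ∃ n ≥ n₀, ∀ m s : ℕ, m ≤ 2 ^ ((Nat.log 2 n + c) ^ c) →
      s ≤ 2 ^ ((Nat.log 2 n + c) ^ c) → ¬ HasAlgDetRepr (perPoly (Fin n) ℂ) m s) :
    ¬ IsQPBounded (fun n => determinantalComplexity (perPoly (Fin n) ℂ)) := by
  rintro ⟨c, hc⟩
  obtain ⟨n, -, hno⟩ := h c 0
  exact hno _ 1 (hc n) Nat.one_le_two_pow
    (hasDetRepr_determinantalComplexity_holds (perPoly (Fin n) ℂ)).hasAlgDetRepr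

/-- `¬ IsQPBounded (n ↦ dc(per_n)) → ValiantsHypothesis` — the route's proved glue `DcqpToVH`,
re-derived from the hub to keep this file's imports inside the GrenetZeon cone (`VP ⊆ VQP` for
`dc`, BCS97 Cor. (21.40); Valiant's `per ∈ VNP`; the `ofFintype` bridge).
[cite: BurgisserClausenShokrollahi1997, Cor. (21.40)] -/
theorem valiantsHypothesis_of_not_isQPBounded_dc
    (hnqp : ¬ IsQPBounded (fun n => determinantalComplexity (perPoly (Fin n) ℂ))) :
    ValiantsHypothesis := by
  refine Summit.ValiantsHypothesis.Hub.valiantsHypothesis_of_not_isVPFamily_per ?_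
    (mem_VP_ofFintype_iff_holds _) (perFamily_mem_VNP_holds ℂ)
  intro hVP
  exact hnqp (isQPBounded_determinantalComplexity_of_isVPFamily_holds (fun n => perPoly (Fin n) ℂ) hVP)

/-- **The infinitely-often route target closes the summit.** [cite: BurgisserClausenShokrollahi1997, Cor. (21.40)] -/
theorem valiantsHypothesis_of_algDcQP_io
    (h : ∀ c n₀ : ℕ, ∃ n ≥ n₀, ∀ m s : ℕ, m ≤ 2 ^ ((Nat.log 2 n + c) ^ c) →
      s ≤ 2 ^ ((Nat.log 2 n + c) ^ c) → ¬ HasAlgDetRepr (perPoly (Fin n) ℂ) m s) :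
    ValiantsHypothesis :=
  valiantsHypothesis_of_not_isQPBounded_dc (not_isQPBounded_dc_of_algDcQP_io h)

/-- **WEAKER deciding conjunction.** `AbelianizationQP` (8063) and the INFINITELY-OFTEN form of
`PolySizeQPAlgebra` (8064 at the corner of its box, for infinitely many `n` at every exponent) already
imply `ValiantsHypothesis` — every other piece of the route's deciding theorem is proved
(`transferToDc_proof`, the split bookkeeping, the hub).  Compare `Theses.GrenetZeon.closes`, which
asks for 8064 almost everywhere. [cite: BurgisserClausenShokrollahi1997, Cor. (21.40)] -/
theorem valiantsHypothesis_of_abelianizationQP_of_polySizeBox_io (hA : AbelianizationQP)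
    (hio : ∀ c n₀ : ℕ, ∃ n ≥ n₀,
      ¬ HasAlgDetRepr (perPoly (Fin n) ℂ) (n ^ c + c) (2 ^ ((Nat.log 2 n + c) ^ c))) :
    ValiantsHypothesis :=
  valiantsHypothesis_of_algDcQP_io (algDcQP_io_of_abelianizationQP hA hio)

/-- The a.e. piece implies the i.o. hypothesis used above, so the weaker deciding conjunction
specialises to the filed one: `AbelianizationQP → PolySizeQPAlgebra → ValiantsHypothesis`.
[cite: BurgisserClausenShokrollahi1997, Cor. (21.40)] -/
theorem valiantsHypothesis_of_abelianizationQP_of_polySizeQPAlgebra (hA : AbelianizationQP)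
    (hP : PolySizeQPAlgebra) : ValiantsHypothesis := by
  refine valiantsHypothesis_of_abelianizationQP_of_polySizeBox_io hA fun c n₀ => ?_
  obtain ⟨n₁, h⟩ := hP c
  exact ⟨max n₀ n₁, le_max_left _ _, h _ (le_max_right _ _) _ _ le_rfl le_rfl⟩

end Summit.ValiantsHypothesis.ValiantsHypothesis.Theorems.GrenetZeonPolySizeQPAlgebra

end
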